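import Summits.KontsevichZagierPeriods.KontsevichZagierPeriods.Theorems.HurwitzMicroSectorsNormalFormPrincipleM4KernelRefs
import Summits.KontsevichZagierPeriods.KontsevichZagierPeriods.Theorems.HurwitzMicroSectorsNormalFormPrincipleM4LevelOneFromLevelTwo
import Summits.KontsevichZagierPeriods.KontsevichZagierPeriods.Theorems.HurwitzMicroSectorsNormalFormPrincipleM4RelBstuffle22pp

/-!
# `NormalFormPrinciple` (stmt-KontsevichZagierPeriods-3869), line `SketchIdeator1` —
# leaf `stub_boxRigidity`, layer `M4` kernel: the four product reductions

Pure proof file (registered sub-goal `m4k4_reduce_log` of the line `SketchIdeator1`, lead seat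
c9; `--supports` the crux). The dimension-four kernel theorem reduces every generator `N` of the
census, after multiplication by `8`, to `α•[Z4] + β•[C1 × Z3]` modulo `KZ.relations`, where
`Z4 = [□⁴, 1/(1 − x₀x₁x₂x₃)]` (`ζ(4)`), `C1 = [(0,1), 1/(1 + x₀)]` (`log 2`) and
`Z3 = [□³, 1/(1 − x₀x₁x₂)]` (`ζ(3)`). Here are the four PRODUCT boxes of the census:

* `[□⁴, 1/((1 + x₀)(1 − x₁x₂x₃))]` (`log 2 · ζ(3)`):  `8[N] ≡ 8[C1 × Z3]`, a congruence with the
  Fubini product (`m4b_of_sub_of_prod_mem_relations`, no move);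
* `[□⁴, 1/((1 + x₀)(1 + x₁x₂x₃))]` (`log 2 · η(3)`):  `8[N] ≡ 6[C1 × Z3]`, the landed
  dimension-three chain `[□³, 4/(1+xyz)] ∼ [□³, 3/(1−xyz)]` (`m4_negZetaThree_box`) crossed with
  the interval in the PRODUCT IDEAL (`KZ.Equivalent.prod`, `KZ.of_mul_mem_relations`) and two
  scalings (`KZ.IntegralRep.of_constMul_nat_sub_nsmul_mem_relations`);
* `[□⁴, 1/((1 − x₀x₁)(1 + x₂x₃))]` (`ζ(2)η(2)`):  `8[N] ≡ 10[Z4]`;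
* `[□⁴, 1/((1 + x₀x₁)(1 + x₂x₃))]` (`η(2)²`):  `8[N] ≡ 5[Z4]`:
  the dimension-two boxes `[□², 1/(1 ∓ xy)]` chart onto the words `ab`, `ac` of `Δ₂`
  (`bss_box_sub_simplex_of_one_le`, `m4l_exists_acBox`, rule (2)), the words-level relations
  `4[ab]·[ac] − 5[aaab]`, `8[ac]·[ac] − 5[aaab]` of `m4r4_exists_words` close the products, and the
  cubical chart (`m4_box_sub_simplex4`, rule (2)) identifies `Z4` with `[aaab]`.

References: M. Kontsevich, D. Zagier, *Periods* (2001), §1.1–1.2 (the moves), §4.1 (products).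
No definitions are introduced.
-/

noncomputable section

open MeasureTheory Set
open Literature.NumberTheory.Transcendental Literature.NumberTheory.Transcendental.KZ
open Literature.ModelTheory.ExponentialFields (IsSemialgebraic)
open Summit.KontsevichZagierPeriods.HurwitzMicroSectors.NormalFormPrinciple.PiBox.Dilog
  (exists_dilogBox bss_box_sub_simplex_of_one_le)

namespace Summit.KontsevichZagierPeriods.HurwitzMicroSectors.NormalFormPrinciple.PiBox.M3

/-- **Registered sub-goal `m4k4_reduce_log` (stmt-KontsevichZagierPeriods-3869, line
`SketchIdeator1`, layer `M4` kernel).** The four product reductions of the dimension-four kernel: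
for the references `Z4 = [□⁴, 1/(1 − x₀x₁x₂x₃)]`, `C1 = [(0,1), 1/(1 + x₀)]`,
`Z3 = [□³, 1/(1 − x₀x₁x₂)]` and every box `N` of one of the four product families,
`8[N] − (α•[Z4] + β•[C1 × Z3]) ∈ KZ.relations` with `(α, β) = (0, 8), (0, 6), (10, 0), (5, 0)`
(`log 2·ζ(3)`, `log 2·η(3) = (3/4) log 2·ζ(3)`, `ζ(2)η(2) = (5/4)ζ(4)`, `η(2)² = (5/8)ζ(4)`).
[cite: KontsevichZagier2001, §1.2 rules (1), (2); §4.1] -/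
theorem m4k4_reduce_log :
    ∀ (Z4 : IntegralRep 4) (C1 : IntegralRep 1) (Z3 : IntegralRep 3),
      Z4.domain = {x | ∀ i, x i ∈ Set.Ioo (0:ℝ) 1} → (Z4.integrand = fun x => 1 / (1 - x 0 * x 1 * x 2 * x 3)) →
      C1.domain = {x | ∀ i, x i ∈ Set.Ioo (0:ℝ) 1} → (C1.integrand = fun x => 1 / (1 + x 0)) →
      Z3.domain = {x | ∀ i, x i ∈ Set.Ioo (0:ℝ) 1} → (Z3.integrand = fun x => 1 / (1 - x 0 * x 1 * x 2)) →
        (∀ N : IntegralRep 4, N.domain = {x | ∀ i, x i ∈ Set.Ioo (0:ℝ) 1} →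
          EqOn N.integrand (fun x => 1 / ((1 + x 0) * (1 - x 1 * x 2 * x 3))) N.domain →
          (8:ℕ) • of N - ((0:ℤ) • of Z4 + (8:ℤ) • of (C1.prod Z3)) ∈ relations) ∧
        (∀ N : IntegralRep 4, N.domain = {x | ∀ i, x i ∈ Set.Ioo (0:ℝ) 1} →
          EqOn N.integrand (fun x => 1 / ((1 + x 0) * (1 + x 1 * x 2 * x 3))) N.domain →
          (8:ℕ) • of N - ((0:ℤ) • of Z4 + (6:ℤ) • of (C1.prod Z3)) ∈ relations) ∧
        (∀ N : IntegralRep 4, N.domain = {x | ∀ i, x i ∈ Set.Ioo (0:ℝ) 1} →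
          EqOn N.integrand (fun x => 1 / ((1 - x 0 * x 1) * (1 + x 2 * x 3))) N.domain →
          (8:ℕ) • of N - ((10:ℤ) • of Z4 + (0:ℤ) • of (C1.prod Z3)) ∈ relations) ∧
        (∀ N : IntegralRep 4, N.domain = {x | ∀ i, x i ∈ Set.Ioo (0:ℝ) 1} →
          EqOn N.integrand (fun x => 1 / ((1 + x 0 * x 1) * (1 + x 2 * x 3))) N.domain →
          (8:ℕ) • of N - ((5:ℤ) • of Z4 + (0:ℤ) • of (C1.prod Z3)) ∈ relations) := by
  intro Z4 C1 Z3 hZ4d hZ4i hC1d hC1i hZ3d hZ3i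
  obtain ⟨AB, AC, _, _, AAAB, _, _, _, ⟨hABd, hABi⟩, ⟨hACd, hACi⟩, -, -, ⟨hAAABd, hAAABi⟩, -, -,
    -, -, -, -, k4, k5, -, -⟩ := m4r4_exists_words C1 hC1d hC1i
  -- the `ζ(4)` box charts onto the word `aaab` (cubical chart, rule (2))
  have cZ : of Z4 - of AAAB ∈ relations := by
    refine m4_box_sub_simplex4.1 (fun t => 1 / t 0 * (1 / t 1) * (1 / t 2) * (1 / (1 - t 3)))
      Z4 AAAB hZ4d hAAABd (fun t _ => by rw [hAAABi]) fun x hx => ?_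
    rw [hZ4d] at hx
    obtain ⟨h0, h1, h2, -, -, -, hP⟩ := m4z_box_facts hx
    rw [hZ4i]
    simp only [Matrix.cons_val_zero, Matrix.cons_val_one, Matrix.head_cons, Matrix.cons_val_two,
      Matrix.tail_cons, Matrix.cons_val_three]
    have hP' : 1 - x 0 * x 1 * x 2 * x 3 ≠ 0 := by linarith
    field_simp
  -- the dimension-two boxes `Bm = [□², 1/(1 − xy)] ∼ [ab]` and `Bp = [□², 1/(1 + xy)] ∼ [ac]`
  obtain ⟨Bm, hBmd, hBmi⟩ := exists_dilogBox isAlgebraic_one (Or.inl le_rfl)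
  have hBA : Equivalent Bm AB :=
    bss_box_sub_simplex_of_one_le (a := 1) (z := 1) isAlgebraic_one le_rfl (one_mul 1) Bm AB hBmd
      (hBmi ▸ fun _ _ => rfl) hABd fun t _ => by rw [hABi]; exact one_div_mul_one_div _ _
  obtain ⟨Bp, hBpd, hBpi, hBC⟩ := m4l_exists_acBox AC hACd hACi
  refine ⟨fun N hNd hNi => ?_, fun N hNd hNi => ?_, fun N hNd hNi => ?_, fun N hNd hNi => ?_⟩
  · -- `[c] × [ζ(3)]`: a congruence with the Fubini product `C1 × Z3`
    have c1 : of N - of (C1.prod Z3) ∈ relations :=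
      m4b_of_sub_of_prod_mem_relations C1 Z3 hC1d hZ3d N hNd fun x hx => by
        rw [hNi hx, hC1i, hZ3i]
        show 1 / ((1 + x 0) * (1 - x 1 * x 2 * x 3)) = 1 / (1 + x 0) * (1 / (1 - x 1 * x 2 * x 3))
        rw [one_div_mul_one_div]
    have e : (8:ℕ) • of N - ((0:ℤ) • of Z4 + (8:ℤ) • of (C1.prod Z3)) =
        (8:ℕ) • (of N - of (C1.prod Z3)) := by
      simp only [zero_smul, zero_add, smul_sub]
      abel
    rw [e]
    exact relations.nsmul_mem c1 _
  · -- `[c] × [η(3)]`: the chain `[□³, 4/(1+xyz)] ∼ [□³, 3/(1−xyz)]` crossed with the interval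
    obtain ⟨Np, hNpd, hNpi⟩ := m4b_exists_negZetaThreeBox
    set Z9 : IntegralRep 3 := Z3.constMul ((3:ℕ):ℝ) (isAlgebraic_nat 3) with hZ9
    set N4 : IntegralRep 4 := N.constMul ((4:ℕ):ℝ) (isAlgebraic_nat 4) with hN4
    have h3 : Equivalent Np Z9 :=
      m4_negZetaThree_box Np Z9 hNpd (hNpi ▸ fun _ _ => rfl)
        (by rw [hZ9, IntegralRep.domain_constMul, hZ3d]) fun x _ => by
        rw [hZ9, IntegralRep.integrand_constMul, hZ3i]
        push_cast
        ring
    have c1 : of N4 - of (C1.prod Np) ∈ relations :=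
      m4b_of_sub_of_prod_mem_relations C1 Np hC1d hNpd N4
        (by rw [hN4, IntegralRep.domain_constMul, hNd]) fun x hx => by
        have hx' : x ∈ N.domain := hx
        rw [hN4, IntegralRep.integrand_constMul, hC1i, hNpi]
        show ((4:ℕ):ℝ) * N.integrand x = 1 / (1 + x 0) * (4 / (1 + x 1 * x 2 * x 3))
        rw [hNi hx']
        show ((4:ℕ):ℝ) * (1 / ((1 + x 0) * (1 + x 1 * x 2 * x 3))) =
          1 / (1 + x 0) * (4 / (1 + x 1 * x 2 * x 3))
        push_cast
        rw [mul_one_div, div_mul_div_comm, one_mul]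
    have c2 : of (C1.prod Np) - of (C1.prod Z9) ∈ relations := (Equivalent.refl C1).prod h3
    have c3 : of (C1.prod Z9) - (3:ℕ) • of (C1.prod Z3) ∈ relations := by
      have h := of_mul_mem_relations C1 (IntegralRep.of_constMul_nat_sub_nsmul_mem_relations Z3 3)
      rwa [mul_sub, mul_smul_comm, of_mul_of, of_mul_of] at h
    have c4 : of N4 - (4:ℕ) • of N ∈ relations :=
      IntegralRep.of_constMul_nat_sub_nsmul_mem_relations N 4
    have e : (8:ℕ) • of N - ((0:ℤ) • of Z4 + (6:ℤ) • of (C1.prod Z3)) =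
        (2:ℕ) • (of N4 - of (C1.prod Np)) + (2:ℕ) • (of (C1.prod Np) - of (C1.prod Z9))
        + (2:ℕ) • (of (C1.prod Z9) - (3:ℕ) • of (C1.prod Z3)) - (2:ℕ) • (of N4 - (4:ℕ) • of N) := by
      simp only [zero_smul, zero_add, smul_sub]
      abel
    rw [e]
    exact relations.sub_mem (relations.add_mem (relations.add_mem (relations.nsmul_mem c1 _)
      (relations.nsmul_mem c2 _)) (relations.nsmul_mem c3 _)) (relations.nsmul_mem c4 _)
  · -- `[ζ(2)] × [η(2)]`: `N ≡ Bm × Bp ∼ [ab] × [ac]`, `4[ab]·[ac] ≡ 5[aaab] ≡ 5[Z4]`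
    have c1 : of N - of (Bm.prod Bp) ∈ relations :=
      m4b_of_sub_of_prod_mem_relations Bm Bp hBmd hBpd N hNd fun x hx => by
        rw [hNi hx, hBmi, hBpi]
        show 1 / ((1 - x 0 * x 1) * (1 + x 2 * x 3)) = 1 / (1 - x 0 * x 1) * (1 / (1 + x 2 * x 3))
        rw [one_div_mul_one_div]
    have c2 : of (Bm.prod Bp) - of (AB.prod AC) ∈ relations := hBA.prod hBC
    have e : (8:ℕ) • of N - ((10:ℤ) • of Z4 + (0:ℤ) • of (C1.prod Z3)) =
        (8:ℕ) • (of N - of (Bm.prod Bp)) + (8:ℕ) • (of (Bm.prod Bp) - of (AB.prod AC))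
        + (2:ℕ) • ((4:ℤ) • of (AB.prod AC) - (5:ℤ) • of AAAB) - (10:ℕ) • (of Z4 - of AAAB) := by
      simp only [zero_smul, add_zero, smul_sub]
      abel
    rw [e]
    exact relations.sub_mem (relations.add_mem (relations.add_mem (relations.nsmul_mem c1 _)
      (relations.nsmul_mem c2 _)) (relations.nsmul_mem k4 _)) (relations.nsmul_mem cZ _)
  · -- `[η(2)] × [η(2)]`: `N ≡ Bp × Bp ∼ [ac] × [ac]`, `8[ac]·[ac] ≡ 5[aaab] ≡ 5[Z4]`
    have c1 : of N - of (Bp.prod Bp) ∈ relations :=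
      m4b_of_sub_of_prod_mem_relations Bp Bp hBpd hBpd N hNd fun x hx => by
        rw [hNi hx, hBpi]
        show 1 / ((1 + x 0 * x 1) * (1 + x 2 * x 3)) = 1 / (1 + x 0 * x 1) * (1 / (1 + x 2 * x 3))
        rw [one_div_mul_one_div]
    have c2 : of (Bp.prod Bp) - of (AC.prod AC) ∈ relations := hBC.prod hBC
    have e : (8:ℕ) • of N - ((5:ℤ) • of Z4 + (0:ℤ) • of (C1.prod Z3)) =
        (8:ℕ) • (of N - of (Bp.prod Bp)) + (8:ℕ) • (of (Bp.prod Bp) - of (AC.prod AC))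
        + ((8:ℤ) • of (AC.prod AC) - (5:ℤ) • of AAAB) - (5:ℕ) • (of Z4 - of AAAB) := by
      simp only [zero_smul, add_zero, smul_sub]
      abel
    rw [e]
    exact relations.sub_mem (relations.add_mem (relations.add_mem (relations.nsmul_mem c1 _)
      (relations.nsmul_mem c2 _)) k5) (relations.nsmul_mem cZ _)

end Summit.KontsevichZagierPeriods.HurwitzMicroSectors.NormalFormPrinciple.PiBox.M3
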